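import Literature.AlgebraicGeometry.HodgeTheory.HodgeGenericQbarDescentFiniteMonodromyProofs
import Literature.AlgebraicGeometry.HodgeTheory.HodgeGenericQbarDescentCompactification
import Literature.AlgebraicGeometry.HodgeTheory.SmoothProjectiveCompactificationProofs
import Literature.AlgebraicGeometry.FundamentalGroup.RiemannExistenceQbarDescent
import Literature.AlgebraicGeometry.HodgeTheory.HodgeRiemannPolarizabilityProofs
import Literature.AlgebraicGeometry.HodgeTheory.AlgebraicClassesPullback
import Literature.AlgebraicGeometry.HodgeTheory.SpreadingOutQbarFamilyProofs
import Literature.AlgebraicGeometry.Resolution.FiniteCoverCompactification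
import HarnessLib

/-!
# Voisin 2007, Prop. 0.7 (finite monodromy ⇒ algebraic, granted HC over `ℚ̄`) from seven single published theorems

Family `hodge`, layer `Literature/AlgebraicGeometry/HodgeTheory`. Proof file (sorry-free, theorems
only, no named fact introduced) of the unit `voisin2007_algebraic_of_finite_monodromyOrbit_of_qbar`
(`HodgeGenericQbarDescent.lean`; C. Voisin, *Hodge loci and absolute Hodge classes*, Compositio
Math. 143 (2007), Prop. 0.7 = arXiv math/0605766 Prop. 1.7, proof at the end of §3), third of three:
`HodgeGenericQbarDescentFiniteMonodromyProofs` assembles the printed proof as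
`voisin2007_algebraic_of_finite_monodromyOrbit_of_qbar_of_inputs (hRE) (hComp) (hGICT) (hpol) (hPull)`
(covering-space half PROVED), `HodgeGenericQbarDescentCompactification` reduces the compactification
input `hComp` to Hironaka over `ℚ̄` + EGA II (base-change bookkeeping PROVED); this file reduces the
covering input `hRE` to Riemann existence + descent of finite étale covers + EGA II
(`finiteCovering_descends_to_qbar_of_riemannExistence`, glue PROVED) and states the end result
`voisin2007_algebraic_of_finite_monodromyOrbit_of_qbar_of_riemannExistence_hironaka`: the named fact
follows from SEVEN single published theorems, each in its standard shape —

* `hRiemann` — Riemann's existence theorem [SGA1, Exp. XII Thm. 5.1: for `S` locally of finite type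
  over `ℂ`, `S' ↦ S'^an` is an equivalence between finite étale covers of `S` and finite étale covers
  of `S^an`, i.e. finite-sheeted topological coverings of `S(ℂ)`; used through essential
  surjectivity];
* `hDescent` — finite étale covers of `S₀ ⊗_{ℚ̄} ℂ` come from `S₀` [SGA1, Exp. XIII Prop. 4.6 with
  `k = ℚ̄`, `Y = Spec ℂ`: `π₁(X ×_k Y) ⥲ π₁(X) × π₁(Y)` for `k` algebraically closed of characteristic
  `0` (schemes of finite type over `k̄` being "fortement désingularisables" by Hironaka), so that base
  change `FEt(S₀) → FEt(S₀ ⊗ ℂ)` is an equivalence for `S₀` connected of finite type];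
* `hFinQP` — a scheme finite over a quasi-projective `ℚ̄`-scheme is quasi-projective [EGA II,
  Cor. 6.1.11 (finite ⇒ projective) with Prop. 5.3.4 (ii)];
* `hHir` — Hironaka's smooth projective compactification over `ℚ̄` [Hironaka 1964, Main Theorem I],
  the `ℚ̄`-instance of the shape of the tree's named fact `Hironaka1964_smoothCompactification` (its
  `ℂ`-instance);
* `hGICT` — Deligne's théorème de la partie fixe, the named fact `deligne_globalInvariantCycles`;
* `hpol` — polarisability of the Hodge structure of a smooth projective variety, the named fact
  `smoothProjective_hodgeStructure_isPolarizable`;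
* `hPull` — pull-back along a morphism of smooth projective varieties preserves algebraic classes
  [Fulton 1998, Cor. 19.2 (b)], in the shape of the hypothesis `hpull` of
  `pulledBackAlgebraicClasses_eq_algebraicClasses_iff`.

The first four and the last have no declaration in the tree (a proving seat may not introduce named
facts, D-0026); `…_holds` is exactly this theorem once they and the two named facts are available.

**Update (2026-08-16, second half of this file).** Three of the seven inputs are now supplied
by the tree: `hHir` is PROVED over every algebraically closed field of characteristic zero
(`exists_isSmoothProjective_isOpenImmersion`, `SmoothProjectiveCompactificationProofs.lean`, from the
strong projective resolution `Resolution/ProjectiveStrongResolution.lean` over Kollár's functorial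
order reduction); `hFinQP` is not needed — the two schemes it was applied to are quasi-projective
by finer means PROVED here: the finite étale cover `S''₀` of the smooth quasi-projective `S₀`
through the normalization of the closure of `S₀` in `S''₀` (de Jong 1996, 4.17; E. Noether's
finiteness, `Resolution/FiniteCoverCompactification.lean`;
`isQuasiProjectiveOver_of_isFinite_of_surjective`), and the fibre product `𝒳₀ ×_{S₀} S''₀` as a
closed subscheme of `𝒳₀ ×_{ℚ̄} S''₀ ⊆ P ×_{ℚ̄} P'` (Segre; `isQuasiProjectiveOver_familyPullback_of_isSeparated`);
and `hPull` is the named fact `fulton1998_map_mem_algebraicClasses`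
(`AlgebraicClassesPullback.lean`). Hence
`voisin2007_algebraic_of_finite_monodromyOrbit_of_qbar_of_riemannExistence`: the named fact follows
from THREE named facts of the tree (`deligne_globalInvariantCycles`,
`smoothProjective_hodgeStructure_isPolarizable`, `fulton1998_map_mem_algebraicClasses`) and the
two theorems of SGA1 in covering form (Riemann existence, Exp. XII Thm. 5.1; descent of finite
étale covers along `ℚ̄ ⊂ ℂ`, Exp. XIII Prop. 4.6); and, the latter two being vendored meanwhile in
the `π₁`/finite-index shape as the named fact
`FundamentalGroup.riemannExistence_qbarDescent_of_finiteIndex`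
(`FundamentalGroup/RiemannExistenceQbarDescent.lean`),
`voisin2007_algebraic_of_finite_monodromyOrbit_of_qbar_of_namedFacts`: the named fact from FOUR
NAMED FACTS of the tree and nothing else (through the sibling assembly
`voisin2007_algebraic_of_finite_monodromyOrbit_of_qbar_of_classical_inputs`); one of them, the
polarisability `smoothProjective_hodgeStructure_isPolarizable`, being DISCHARGED in the tree
(`smoothProjective_hodgeStructure_isPolarizable_holds`, `HodgeRiemannPolarizabilityProofs.lean`),
`voisin2007_algebraic_of_finite_monodromyOrbit_of_qbar_of_threeNamedFacts` leaves exactly THREE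
unproved named facts: `FundamentalGroup.riemannExistence_qbarDescent_of_finiteIndex`,
`deligne_globalInvariantCycles`, `fulton1998_map_mem_algebraicClasses`.

Compare the sibling `HodgeGenericQbarDescentProofs.voisin2007_algebraic_of_finite_monodromyOrbit_of_qbar_of_classical_inputs`
(another seat, same fact), whose covering input is phrased through finite-index subgroups of
`π₁(S(ℂ), s)` and whose compactification input is the composite family-level statement: here the
covering is CONSTRUCTED (path component of `(s, α)` in the étalé space of `R²ᵖ f_* ℂ`) and the inputs
are split down to single theorems.

## References

* [Voisin2007HodgeLoci] C. Voisin, Hodge loci and absolute Hodge classes, Compositio Math. 143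
  (2007), §3, proof of Prop. 0.7 (arXiv math/0605766: Prop. 1.7, p. 7).
* [SGA1] A. Grothendieck, M. Raynaud, SGA 1 (arXiv:math/0206203), Exp. XII Thm. 5.1 (p. 333),
  Prop. 2.4; Exp. XIII Prop. 4.6 (p. 421).
* [EGAII] A. Grothendieck, Éléments de géométrie algébrique II, Publ. Math. IHÉS 8 (1961),
  Prop. 5.3.4 (ii), Cor. 6.1.11.
* [Hironaka1964] H. Hironaka, Ann. of Math. 79 (1964), Main Theorem I.
* [DeligneHodgeII1971] P. Deligne, Théorie de Hodge II, Publ. Math. IHÉS 40 (1971), Thm. 4.1.1.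
* [Fulton1998] W. Fulton, Intersection Theory, 2nd ed., Cor. 19.2 (b).
* [CharlesSchnell2014Notes] F. Charles, C. Schnell, Notes on absolute Hodge classes, Thm. 11.3.19.
* [DeJong1996] A. J. de Jong, Smoothness, semi-stability and alterations, Publ. Math. IHÉS 83
  (1996), 4.17 (p. 72).
* [Hartshorne1977] R. Hartshorne, Algebraic Geometry, II §4 (p. 103), II Cor. 4.6, II Ex. 4.9.
-/

noncomputable section

open CategoryTheory AlgebraicGeometry
open _root_.Topology
open Literature.AlgebraicTopology.SingularHomology

namespace Literature.AlgebraicGeometry.HodgeTheory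

section ClassicalInputs

open Literature.AlgebraicGeometry.Motives

/-! ### The inputs in classical shape: Riemann existence, descent of covers, EGA II, Hironaka over `ℚ̄` -/

/-- **The covering input `hRE` of `voisin2007_algebraic_of_finite_monodromyOrbit_of_qbar_of_inputs`
from two classical theorems in their standard shape**: (i) the *Riemann existence theorem*
(`hRiemann`: SGA1 Exp. XII Thm. 5.1 — for `S` locally of finite type over `ℂ`, `S' ↦ S'^an` is an
equivalence between finite étale covers of `S` and finite (topological) coverings of `S^an = S(ℂ)`;
used: essential surjectivity, "a finite-sheeted covering space of `S(ℂ)` is `S'(ℂ)` for a finite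
étale `S' → S`"), and (ii) *descent of finite étale covers along an extension of algebraically closed
fields of characteristic zero* (`hDescent`: SGA1 Exp. XIII Prop. 4.6 with `Y = Spec ℂ`, `k = ℚ̄` —
"`π₁(X ×_k Y) ⥲ π₁(X) × π₁(Y)`", so `FEt(S₀) → FEt(S₀ ⊗_{ℚ̄} ℂ)` is an equivalence for `S₀` connected
of finite type over `ℚ̄`; used: essential surjectivity on connected covers, "an étale cover `S''` …,
also defined over `ℚ̄`"), plus (iii) EGA II (`hFinQP`: finite over quasi-projective is
quasi-projective) for the quasi-projectivity of the descended cover. PROVED glue: connectedness of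
the cover from that of `T` (`ComplexPoints.connectedSpace_left_of_connectedSpace`, SGA1 XII 2.4) and
transport of the homeomorphism along `e(ℂ)` (`AlgPoints.homeomorphOfIso`).
[cite: SGA1, Exp. XII Thm. 5.1 (p. 333) and Exp. XIII Prop. 4.6 (p. 421)] [cite: EGAII, Cor. 6.1.11] -/
theorem finiteCovering_descends_to_qbar_of_riemannExistence
    (hRiemann : ∀ (S : SchemeOver ℂ), IsQuasiProjectiveOver S →
      ∀ (T : Type) [TopologicalSpace T] (q : T → ComplexPoints S),
        IsCoveringMap q → (∀ t, (q ⁻¹' {t}).Finite) →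
        ∃ (S' : SchemeOver ℂ) (g : S' ⟶ S) (Φ : ComplexPoints S' ≃ₜ T),
          IsFinite g.left ∧ Etale g.left ∧ ∀ z, q (Φ z) = AlgPoints.map g z)
    (hDescent : ∀ (σ : AlgebraicClosure ℚ →+* ℂ) (S₀ : SchemeOver (AlgebraicClosure ℚ)),
      IsQuasiProjectiveOver S₀ → IrreducibleSpace S₀.left →
      ∀ ⦃S' : SchemeOver ℂ⦄ (g : S' ⟶ (baseChangeHom σ).obj S₀),
        IsFinite g.left → Etale g.left → ConnectedSpace S'.left →
        ∃ (S''₀ : SchemeOver (AlgebraicClosure ℚ)) (g₀ : S''₀ ⟶ S₀)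
          (e : (baseChangeHom σ).obj S''₀ ≅ S'),
          IsFinite g₀.left ∧ Etale g₀.left ∧ e.hom ≫ g = (baseChangeHom σ).map g₀)
    (hFinQP : ∀ ⦃X Y : SchemeOver (AlgebraicClosure ℚ)⦄ (h : X ⟶ Y), IsFinite h.left →
      IsQuasiProjectiveOver Y → IsQuasiProjectiveOver X)
    (σ : AlgebraicClosure ℚ →+* ℂ) (S₀ : SchemeOver (AlgebraicClosure ℚ))
    (hS₀ : IsQuasiProjectiveOver S₀) (hS₀irr : IrreducibleSpace S₀.left)
    (T : Type) [TopologicalSpace T] [ConnectedSpace T]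
    (q : T → ComplexPoints ((baseChangeHom σ).obj S₀)) (hq : IsCoveringMap q)
    (hqfin : ∀ t, (q ⁻¹' {t}).Finite) :
    ∃ (S''₀ : SchemeOver (AlgebraicClosure ℚ)) (g₀ : S''₀ ⟶ S₀)
      (Φ : ComplexPoints ((baseChangeHom σ).obj S''₀) ≃ₜ T),
      IsFinite g₀.left ∧ Etale g₀.left ∧ IsQuasiProjectiveOver S''₀ ∧
        ∀ z, q (Φ z) = AlgPoints.map ((baseChangeHom σ).map g₀) z := by
  have hS : IsQuasiProjectiveOver ((baseChangeHom σ).obj S₀) := hS₀.baseChangeHom σ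
  -- Riemann existence: `T = S'(ℂ)` for a finite étale `g : S' → S₀ ⊗_σ ℂ`
  obtain ⟨S', g, Φ, hfin, het, hΦ⟩ := hRiemann _ hS T q hq hqfin
  haveI := hfin
  haveI := het
  -- `S'` is connected since `S'(ℂ) ≃ T` is (closed points are dense)
  haveI : LocallyOfFiniteType ((baseChangeHom σ).obj S₀).hom := hS.locallyOfFiniteType
  haveI : LocallyOfFiniteType S'.hom := by
    rw [← Over.w g]
    infer_instance
  haveI : ConnectedSpace (ComplexPoints S') :=
    Φ.symm.surjective.connectedSpace Φ.symm.continuous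
  haveI : ConnectedSpace S'.left := Motives.ComplexPoints.connectedSpace_left_of_connectedSpace (X := S')
  -- descent to `ℚ̄`
  obtain ⟨S''₀, g₀, e, hfin₀, het₀, he⟩ := hDescent σ S₀ hS₀ hS₀irr g hfin het inferInstance
  refine ⟨S''₀, g₀, (AlgPoints.homeomorphOfIso e).trans Φ, hfin₀, het₀, hFinQP g₀ hfin₀ hS₀, fun z ↦ ?_⟩
  rw [Homeomorph.trans_apply, AlgPoints.coe_homeomorphOfIso, hΦ, ← AlgPoints.map_comp_apply, he]

/-- **Voisin 2007, Prop. 0.7 (= arXiv Prop. 1.7) from seven classical theorems** — the assembled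
proof `voisin2007_algebraic_of_finite_monodromyOrbit_of_qbar_of_inputs` with its two composite
hypotheses `hRE` and `hComp` reduced to single published theorems in their standard shape (all the
bookkeeping — base change of families along `σ : ℚ̄ →+* ℂ`, faithfully flat descent of smoothness,
irreducibility and pure dimension of `𝒳₀ ×_{S₀} S''₀`, connectedness of covers, transport along
`e(ℂ)` — being PROVED, here and in `HodgeGenericQbarDescentCompactification`):

* `hRiemann` — Riemann existence theorem [SGA1, Exp. XII Thm. 5.1];
* `hDescent` — finite étale covers of `S₀ ⊗_{ℚ̄} ℂ` descend to `ℚ̄` [SGA1, Exp. XIII Prop. 4.6];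
* `hFinQP` — a scheme finite over a quasi-projective `ℚ̄`-scheme is quasi-projective
  [EGA II, Cor. 6.1.11 with Prop. 5.3.4 (ii)];
* `hHir` — Hironaka's smooth projective compactification over `ℚ̄` [Hironaka 1964, Main Theorem I]
  (the `ℚ̄`-instance of the shape of the tree's named fact `Hironaka1964_smoothCompactification`);
* `hGICT` — Deligne's théorème de la partie fixe (named fact `deligne_globalInvariantCycles`);
* `hpol` — polarisability of `H^{2p}` of a smooth projective variety (named fact
  `smoothProjective_hodgeStructure_isPolarizable`);
* `hPull` — pull-back preserves algebraic classes [Fulton 1998, Cor. 19.2 (b)] (shape of the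
  hypothesis `hpull` of `pulledBackAlgebraicClasses_eq_algebraicClasses_iff`).
[cite: Voisin2007HodgeLoci, §3, proof of Prop. 1.7 (arXiv math/0605766 p. 7; Compositio Prop. 0.7)]
[cite: SGA1, Exp. XII Thm. 5.1 and Exp. XIII Prop. 4.6] [cite: EGAII, Cor. 6.1.11]
[cite: Hironaka1964, Main Theorem I] [cite: DeligneHodgeII1971, Théorème 4.1.1]
[cite: Fulton1998, Cor. 19.2 (b)] -/
theorem voisin2007_algebraic_of_finite_monodromyOrbit_of_qbar_of_riemannExistence_hironaka
    (hRiemann : ∀ (S : SchemeOver ℂ), IsQuasiProjectiveOver S →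
      ∀ (T : Type) [TopologicalSpace T] (q : T → ComplexPoints S),
        IsCoveringMap q → (∀ t, (q ⁻¹' {t}).Finite) →
        ∃ (S' : SchemeOver ℂ) (g : S' ⟶ S) (Φ : ComplexPoints S' ≃ₜ T),
          IsFinite g.left ∧ Etale g.left ∧ ∀ z, q (Φ z) = AlgPoints.map g z)
    (hDescent : ∀ (σ : AlgebraicClosure ℚ →+* ℂ) (S₀ : SchemeOver (AlgebraicClosure ℚ)),
      IsQuasiProjectiveOver S₀ → IrreducibleSpace S₀.left →
      ∀ ⦃S' : SchemeOver ℂ⦄ (g : S' ⟶ (baseChangeHom σ).obj S₀),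
        IsFinite g.left → Etale g.left → ConnectedSpace S'.left →
        ∃ (S''₀ : SchemeOver (AlgebraicClosure ℚ)) (g₀ : S''₀ ⟶ S₀)
          (e : (baseChangeHom σ).obj S''₀ ≅ S'),
          IsFinite g₀.left ∧ Etale g₀.left ∧ e.hom ≫ g = (baseChangeHom σ).map g₀)
    (hFinQP : ∀ ⦃X Y : SchemeOver (AlgebraicClosure ℚ)⦄ (h : X ⟶ Y), IsFinite h.left →
      IsQuasiProjectiveOver Y → IsQuasiProjectiveOver X)
    (hHir : ∀ (m : ℕ) (X : SchemeOver (AlgebraicClosure ℚ)), SmoothOfRelativeDimension m X.hom →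
      IsQuasiProjectiveOver X → IrreducibleSpace X.left →
      ∃ (Xbar : SchemeOver (AlgebraicClosure ℚ)) (i : X ⟶ Xbar),
        IsSmoothProjective m Xbar ∧ IsOpenImmersion i.left)
    (hGICT : deligne_globalInvariantCycles) (hpol : smoothProjective_hodgeStructure_isPolarizable)
    (hPull : ∀ ⦃n m : ℕ⦄ ⦃X Y : SchemeOver ℂ⦄, IsSmoothProjective n X → IsSmoothProjective m Y →
      ∀ (g : X ⟶ Y) (p : ℕ) ⦃a : complexBetti Y (2 * p)⦄, a ∈ algebraicClasses Y p →
        (complexBetti.map g (2 * p)).hom a ∈ algebraicClasses X p) :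
    voisin2007_algebraic_of_finite_monodromyOrbit_of_qbar :=
  voisin2007_algebraic_of_finite_monodromyOrbit_of_qbar_of_inputs
    (fun σ S₀ hS₀ _ hS₀irr T _ _ q hq hqfin ↦
      finiteCovering_descends_to_qbar_of_riemannExistence hRiemann hDescent hFinQP σ S₀ hS₀ hS₀irr
        T q hq hqfin)
    (fun σ _ _ _ f₀ g₀ n h𝒳₀ _ hS''₀ hS₀sm hfin het hconn hf ↦
      exists_smoothProjective_baseChangeHom_compactification_familyPullback hFinQP hHir σ f₀ g₀ n
        h𝒳₀ hS''₀ hS₀sm hfin het hconn hf)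
    hGICT hpol hPull

end ClassicalInputs

/-! ### Quasi-projectivity without EGA II: closed subschemes, fibre products, finite covers (any field) -/

section QuasiProjective

open Literature.AlgebraicGeometry.Motives Literature.AlgebraicGeometry.Resolution MonoidalCategory
open CategoryTheory.Limits

universe u

variable {k : Type u} [Field k]

/-- A quasi-projective `k`-scheme is separated over `k` (open in a projective, hence proper,
`k`-scheme). [cite: Hartshorne1977, II Cor. 4.6] -/
theorem isSeparated_hom_of_isQuasiProjectiveOver {S : SchemeOver k} (hS : IsQuasiProjectiveOver S) :
    IsSeparated S.hom := by
  obtain ⟨P, j, hP, hj⟩ := hS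
  haveI := hj
  haveI : IsProper P.hom := hP.isProper
  rw [← Over.w j]
  infer_instance

/-- A quasi-projective `k`-scheme is locally of finite type over `k`. [folklore] -/
theorem locallyOfFiniteType_hom_of_isQuasiProjectiveOver {S : SchemeOver k}
    (hS : IsQuasiProjectiveOver S) : LocallyOfFiniteType S.hom := by
  obtain ⟨P, j, hP, hj⟩ := hS
  haveI := hj
  haveI : IsProper P.hom := hP.isProper
  rw [← Over.w j]
  infer_instance

/-- **A closed subscheme of a quasi-projective `k`-scheme is quasi-projective** (any field `k`;
the case `k = ℂ` is `IsQuasiProjectiveOver.of_isClosedImmersion`): `X ↪ Y ↪ P` is a quasi-compact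
immersion into a projective scheme (`SpreadingOutQbar.isQuasiProjectiveOver_of_isImmersion`).
[cite: Hartshorne1977, II §4 Definition (quasi-projective morphism), p. 103] -/
theorem isQuasiProjectiveOver_of_isClosedImmersion_of_field {X Y : SchemeOver k} (c : X ⟶ Y)
    [IsClosedImmersion c.left] (hY : IsQuasiProjectiveOver Y) : IsQuasiProjectiveOver X := by
  obtain ⟨P, j, hP, hj⟩ := hY
  haveI := hj
  haveI : IsProper P.hom := hP.isProper
  haveI : IsLocallyNoetherian P.left := LocallyOfFiniteType.isLocallyNoetherian P.hom
  haveI : IsImmersion (c ≫ j).left := by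
    rw [Over.comp_left]
    infer_instance
  haveI : QuasiCompact (c ≫ j).left := by
    rw [Over.comp_left]
    infer_instance
  exact SpreadingOutQbar.isQuasiProjectiveOver_of_isImmersion (c ≫ j) hP

/-- **Products of quasi-projective `k`-schemes are quasi-projective**: `j ⊗ j' : X ⊗ Y ⟶ P ⊗ P'`
is an open immersion into the projective `P ⊗ P'` (Segre, `IsProjectiveOver.tensor`).
[cite: Hartshorne1977, II Ex. 4.9 (Segre embedding) and §4 p. 103] -/
theorem isQuasiProjectiveOver_tensorObj_of_field {X Y : SchemeOver k} (hX : IsQuasiProjectiveOver X)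
    (hY : IsQuasiProjectiveOver Y) : IsQuasiProjectiveOver (X ⊗ Y) := by
  obtain ⟨P, j, hP, hj⟩ := hX
  obtain ⟨P', j', hP', hj'⟩ := hY
  refine ⟨P ⊗ P', j ⊗ₘ j', hP.tensor hP', ?_⟩
  rw [Over.tensorHom_left]
  exact MorphismProperty.pullbackMap (P := @IsOpenImmersion) hj hj' (Over.w j).symm (Over.w j').symm

/-- **Fibre products of quasi-projective `k`-schemes over a separated base are quasi-projective**:
`X ×_S Y ⟶ X ×_k Y` is the base change of the diagonal `S ⟶ S ×_k S` (Mathlib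
`pullback_map_diagonal_isPullback`), a closed immersion for `S` separated over `k`, and
`X ×_k Y = X ⊗ Y` is quasi-projective. [cite: Hartshorne1977, II Cor. 4.6 and §4 p. 103] -/
theorem isQuasiProjectiveOver_familyPullback_of_isSeparated {𝒳 S S' : SchemeOver k} (f : 𝒳 ⟶ S)
    (g : S' ⟶ S) [IsSeparated S.hom] (h𝒳 : IsQuasiProjectiveOver 𝒳)
    (hS' : IsQuasiProjectiveOver S') : IsQuasiProjectiveOver (familyPullback f g) := by
  -- `𝒳 ×_k S'`, written as a base change over the terminal `k`-scheme, is quasi-projective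
  have hY : IsQuasiProjectiveOver (familyPullback (f ≫ CartesianMonoidalCategory.toUnit S)
      (g ≫ CartesianMonoidalCategory.toUnit S)) := by
    rw [CartesianMonoidalCategory.toUnit_unique (f ≫ CartesianMonoidalCategory.toUnit S)
        (CartesianMonoidalCategory.toUnit 𝒳),
      CartesianMonoidalCategory.toUnit_unique (g ≫ CartesianMonoidalCategory.toUnit S)
        (CartesianMonoidalCategory.toUnit S')]
    exact isQuasiProjectiveOver_tensorObj_of_field h𝒳 hS'
  -- the comparison `𝒳 ×_S S' ⟶ 𝒳 ×_k S'` is a closed immersion (base change of the diagonal of `S`)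
  let c : familyPullback f g ⟶ familyPullback (f ≫ CartesianMonoidalCategory.toUnit S)
      (g ≫ CartesianMonoidalCategory.toUnit S) :=
    Over.homMk (pullback.map f.left g.left (f.left ≫ S.hom) (g.left ≫ S.hom) (𝟙 _) (𝟙 _) S.hom
      (Category.id_comp _).symm (Category.id_comp _).symm) (by
        change pullback.map f.left g.left (f.left ≫ S.hom) (g.left ≫ S.hom) (𝟙 _) (𝟙 _) S.hom _ _ ≫
            pullback.fst (f.left ≫ S.hom) (g.left ≫ S.hom) ≫ 𝒳.hom = pullback.fst f.left g.left ≫ 𝒳.hom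
        rw [pullback.lift_fst_assoc, Category.comp_id])
  haveI : IsClosedImmersion c.left :=
    MorphismProperty.of_isPullback (P := @IsClosedImmersion)
      (pullback_map_diagonal_isPullback f.left g.left S.hom) inferInstance
  exact isQuasiProjectiveOver_of_isClosedImmersion_of_field c hY

/-- **A finite surjective cover of an integral quasi-projective `k`-scheme by an integral scheme is
quasi-projective** (the compactification of a finite cover in de Jong 1996, 4.17: `S'' ⊆ N`, the
normalization of the closure `Z ⊆ P` of `S` in `S'' → S ⊆ Z`, is open
(`Resolution.isOpenImmersion_toNormalization`) and `N → Z` is finite by E. Noether's theorem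
(`Resolution.isFinite_fromNormalization_comp_ι`), so `N` is projective over `k`, being finite over
`Z ↪ P ↪ ℙⁿ_k` (`Motives.isProjectiveOver_of_isFinite`)). This replaces, for the covers of Voisin's
proof, EGA II Cor. 6.1.11. [cite: DeJong1996, 4.17 (p. 72)] [cite: Hartshorne1977, II §4 p. 103] -/
theorem isQuasiProjectiveOver_of_isFinite_of_surjective {S'' S : SchemeOver k} (g₀ : S'' ⟶ S)
    [IsFinite g₀.left] [Surjective g₀.left] [IsIntegral S''.left] [IsIntegral S.left]
    (hS : IsQuasiProjectiveOver S) : IsQuasiProjectiveOver S'' := by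
  obtain ⟨P, j, hP, hj⟩ := hS
  haveI := hj
  haveI : IsProper P.hom := hP.isProper
  haveI : IsLocallyNoetherian P.left := LocallyOfFiniteType.isLocallyNoetherian P.hom
  -- the closure `Z` of `S` in `P`
  obtain ⟨Z, c, s, hZint, hc, hsc, hs, -, -⟩ :=
    exists_graphClosure_compactification j.left (𝟙 P.left) j.left (Category.comp_id _)
  haveI := hZint
  haveI := hc
  haveI := hs
  let πZ : Z ⟶ Spec (CommRingCat.of k) := c ≫ P.hom
  haveI : IsProper πZ := inferInstance
  haveI : IsLocallyNoetherian Z := LocallyOfFiniteType.isLocallyNoetherian πZ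
  -- `S'' → s(S) ⊆ Z`, finite and surjective
  let U₀ : Z.Opens := s.opensRange
  let e : S''.left ⟶ (U₀ : Scheme.{u}) := g₀.left ≫ s.isoOpensRange.hom
  have heι : e ≫ U₀.ι = g₀.left ≫ s := by
    simp only [e, U₀, Category.assoc, Scheme.Hom.isoOpensRange_hom_ι]
  haveI : IsFinite e := inferInstance
  haveI : Surjective e := inferInstance
  haveI : QuasiCompact (e ≫ U₀.ι) := inferInstance
  haveI : QuasiSeparated (e ≫ U₀.ι) := inferInstance
  -- the normalization `N` of `Z` in `S''`: `S'' ↪ N` is open, `N → Z` is finite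
  haveI : IsOpenImmersion (e ≫ U₀.ι).toNormalization := isOpenImmersion_toNormalization e U₀.ι
  haveI : IsFinite (e ≫ U₀.ι).fromNormalization := isFinite_fromNormalization_comp_ι U₀ e πZ
  -- `N` is projective over `k`: proper, and finite over `Z ↪ P ↪ ℙⁿ_k`
  obtain ⟨n, eP, heP⟩ := hP
  haveI := heP
  let N : SchemeOver k := Over.mk ((e ≫ U₀.ι).fromNormalization ≫ πZ)
  haveI : IsProper N.hom := inferInstanceAs (IsProper ((e ≫ U₀.ι).fromNormalization ≫ πZ))
  let r : N ⟶ projectiveSpace n k :=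
    Over.homMk ((e ≫ U₀.ι).fromNormalization ≫ c ≫ eP.left) (by
      change ((e ≫ U₀.ι).fromNormalization ≫ c ≫ eP.left) ≫ (projectiveSpace n k).hom =
        (e ≫ U₀.ι).fromNormalization ≫ c ≫ P.hom
      simp only [Category.assoc, Over.w eP])
  haveI : IsFinite r.left := inferInstanceAs (IsFinite ((e ≫ U₀.ι).fromNormalization ≫ c ≫ eP.left))
  have hN : IsProjectiveOver N := isProjectiveOver_of_isFinite r
  -- `S''` is an open subscheme of `N` over `k`
  have hw : (e ≫ U₀.ι).toNormalization ≫ N.hom = S''.hom := by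
    change (e ≫ U₀.ι).toNormalization ≫ (e ≫ U₀.ι).fromNormalization ≫ c ≫ P.hom = S''.hom
    rw [← Category.assoc, Scheme.Hom.toNormalization_fromNormalization, heι, Category.assoc,
      ← Category.assoc s c, hsc, Over.w j, Over.w g₀]
  let ι : S'' ⟶ N := Over.homMk (e ≫ U₀.ι).toNormalization hw
  haveI : IsImmersion ι.left := inferInstanceAs (IsImmersion (e ≫ U₀.ι).toNormalization)
  haveI : IsLocallyNoetherian N.left := LocallyOfFiniteType.isLocallyNoetherian N.hom
  haveI : QuasiCompact ι.left := inferInstanceAs (QuasiCompact (e ≫ U₀.ι).toNormalization)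
  exact SpreadingOutQbar.isQuasiProjectiveOver_of_isImmersion ι hN

end QuasiProjective

/-! ### The covering and compactification inputs from Riemann existence and descent alone -/

section WithoutEGAII

open Literature.AlgebraicGeometry.Motives Literature.AlgebraicGeometry.Resolution CategoryTheory.Limits

/-- **The covering input `hRE` from Riemann existence and descent alone** (no EGA II): as
`finiteCovering_descends_to_qbar_of_riemannExistence`, with the quasi-projectivity of the
descended cover `S''₀ → S₀` PROVED (`isQuasiProjectiveOver_of_isFinite_of_surjective`): `S₀` is
smooth and irreducible, hence integral; `S''₀` is étale over `S₀` (smooth, reduced) and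
irreducible (its complexification `S' ≅ S''₀ ⊗_σ ℂ` is smooth with connected complex points,
`irreducibleSpace_left_of_connectedSpace_complexPoints`), hence integral; and `S''₀ → S₀` is
surjective (finite, hence closed, and étale, hence open, onto the irreducible `S₀`).
[cite: SGA1, Exp. XII Thm. 5.1 (p. 333) and Exp. XIII Prop. 4.6 (p. 421)] [cite: DeJong1996, 4.17 (p. 72)] -/
theorem finiteCovering_descends_to_qbar_of_riemannExistence_of_smooth
    (hRiemann : ∀ (S : SchemeOver ℂ), IsQuasiProjectiveOver S →
      ∀ (T : Type) [TopologicalSpace T] (q : T → ComplexPoints S),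
        IsCoveringMap q → (∀ t, (q ⁻¹' {t}).Finite) →
        ∃ (S' : SchemeOver ℂ) (g : S' ⟶ S) (Φ : ComplexPoints S' ≃ₜ T),
          IsFinite g.left ∧ Etale g.left ∧ ∀ z, q (Φ z) = AlgPoints.map g z)
    (hDescent : ∀ (σ : AlgebraicClosure ℚ →+* ℂ) (S₀ : SchemeOver (AlgebraicClosure ℚ)),
      IsQuasiProjectiveOver S₀ → IrreducibleSpace S₀.left →
      ∀ ⦃S' : SchemeOver ℂ⦄ (g : S' ⟶ (baseChangeHom σ).obj S₀),
        IsFinite g.left → Etale g.left → ConnectedSpace S'.left →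
        ∃ (S''₀ : SchemeOver (AlgebraicClosure ℚ)) (g₀ : S''₀ ⟶ S₀)
          (e : (baseChangeHom σ).obj S''₀ ≅ S'),
          IsFinite g₀.left ∧ Etale g₀.left ∧ e.hom ≫ g = (baseChangeHom σ).map g₀)
    (σ : AlgebraicClosure ℚ →+* ℂ) (S₀ : SchemeOver (AlgebraicClosure ℚ))
    (hS₀ : IsQuasiProjectiveOver S₀) (hS₀sm : AlgebraicGeometry.Smooth S₀.hom)
    (hS₀irr : IrreducibleSpace S₀.left)
    (T : Type) [TopologicalSpace T] [ConnectedSpace T]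
    (q : T → ComplexPoints ((baseChangeHom σ).obj S₀)) (hq : IsCoveringMap q)
    (hqfin : ∀ t, (q ⁻¹' {t}).Finite) :
    ∃ (S''₀ : SchemeOver (AlgebraicClosure ℚ)) (g₀ : S''₀ ⟶ S₀)
      (Φ : ComplexPoints ((baseChangeHom σ).obj S''₀) ≃ₜ T),
      IsFinite g₀.left ∧ Etale g₀.left ∧ IsQuasiProjectiveOver S''₀ ∧
        ∀ z, q (Φ z) = AlgPoints.map ((baseChangeHom σ).map g₀) z := by
  haveI := hS₀sm
  haveI := hS₀irr
  have hS : IsQuasiProjectiveOver ((baseChangeHom σ).obj S₀) := hS₀.baseChangeHom σ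
  -- Riemann existence: `T = S'(ℂ)` for a finite étale `g : S' → S₀ ⊗_σ ℂ`
  obtain ⟨S', g, Φ, hfin, het, hΦ⟩ := hRiemann _ hS T q hq hqfin
  haveI := hfin
  haveI := het
  haveI : LocallyOfFiniteType ((baseChangeHom σ).obj S₀).hom := hS.locallyOfFiniteType
  haveI : LocallyOfFiniteType S'.hom := by
    rw [← Over.w g]
    infer_instance
  haveI : ConnectedSpace (ComplexPoints S') :=
    Φ.symm.surjective.connectedSpace Φ.symm.continuous
  haveI : ConnectedSpace S'.left := Motives.ComplexPoints.connectedSpace_left_of_connectedSpace (X := S')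
  -- `S'` is smooth over `ℂ` (étale over the smooth `S₀ ⊗_σ ℂ`), hence irreducible
  haveI : AlgebraicGeometry.Smooth ((baseChangeHom σ).obj S₀).hom := by
    change AlgebraicGeometry.Smooth (pullback.snd S₀.hom _)
    infer_instance
  haveI : AlgebraicGeometry.Smooth S'.hom := by
    rw [← Over.w g]
    infer_instance
  haveI : IrreducibleSpace S'.left := irreducibleSpace_left_of_connectedSpace_complexPoints
  -- descent to `ℚ̄`
  obtain ⟨S''₀, g₀, e, hfin₀, het₀, he⟩ := hDescent σ S₀ hS₀ hS₀irr g hfin het inferInstance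
  haveI := hfin₀
  haveI := het₀
  -- `S₀` and `S''₀` are integral
  have hS₀reg : Scheme.IsRegular S₀.left :=
    Scheme.IsRegular.of_smooth S₀.hom (Scheme.isRegular_Spec (CommRingCat.of (AlgebraicClosure ℚ)))
  haveI : IsReduced S₀.left := hS₀reg.isReduced
  haveI : IsIntegral S₀.left := isIntegral_of_irreducibleSpace_of_isReduced _
  let e' : ((baseChangeHom σ).obj S''₀).left ≅ S'.left := (Over.forget _).mapIso e
  haveI : IrreducibleSpace ((baseChangeHom σ).obj S''₀).left :=
    (Scheme.homeoOfIso e').symm.surjective.irreducibleSpace (Scheme.homeoOfIso e').symm.continuous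
  haveI : IrreducibleSpace S''₀.left := irreducibleSpace_of_irreducibleSpace_baseChangeHom_obj σ S''₀
  haveI : AlgebraicGeometry.Smooth S''₀.hom := by
    rw [← Over.w g₀]
    infer_instance
  have hS''reg : Scheme.IsRegular S''₀.left :=
    Scheme.IsRegular.of_smooth S''₀.hom (Scheme.isRegular_Spec (CommRingCat.of (AlgebraicClosure ℚ)))
  haveI : IsReduced S''₀.left := hS''reg.isReduced
  haveI : IsIntegral S''₀.left := isIntegral_of_irreducibleSpace_of_isReduced _
  -- `g₀` is surjective: closed (finite) and open (étale) onto the irreducible `S₀`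
  haveI : Nonempty S''₀.left := by
    obtain ⟨x⟩ := (inferInstance : Nonempty S'.left)
    exact ⟨baseChangeHomFst σ S''₀ (e'.inv.base x)⟩
  haveI : Surjective g₀.left := by
    refine ⟨fun y => ?_⟩
    have huniv : Set.range g₀.left = Set.univ :=
      IsClopen.eq_univ ⟨g₀.left.isClosedMap.isClosed_range, g₀.left.isOpenMap.isOpen_range⟩
        (Set.range_nonempty _)
    show y ∈ Set.range g₀.left
    rw [huniv]
    trivial
  refine ⟨S''₀, g₀, (AlgPoints.homeomorphOfIso e).trans Φ, hfin₀, het₀,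
    isQuasiProjectiveOver_of_isFinite_of_surjective g₀ hS₀, fun z ↦ ?_⟩
  rw [Homeomorph.trans_apply, AlgPoints.coe_homeomorphOfIso, hΦ, ← AlgPoints.map_comp_apply, he]

/-- The complexification `S''₀ ⊗_σ ℂ` of an étale `S''₀ → S₀` over the smooth `S₀/ℚ̄`, with `S''₀`
quasi-projective, is irreducible as soon as its complex points form a connected space: it is smooth
over `ℂ` (étale over the smooth `S₀ ⊗_σ ℂ`), and a smooth `ℂ`-scheme of finite type with connected
complex points is irreducible (`irreducibleSpace_left_of_connectedSpace_complexPoints`).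
[cite: SGA1, Exp. XII Prop. 2.4 (p. 322) and Exp. I Prop. 10.1] -/
theorem irreducibleSpace_baseChangeHom_obj_left_of_connectedSpace_complexPoints
    (σ : AlgebraicClosure ℚ →+* ℂ) {S''₀ S₀ : SchemeOver (AlgebraicClosure ℚ)} (g₀ : S''₀ ⟶ S₀)
    (hS''₀ : IsQuasiProjectiveOver S''₀) (hS₀sm : AlgebraicGeometry.Smooth S₀.hom)
    (het : Etale g₀.left) (hconn : ConnectedSpace (ComplexPoints ((baseChangeHom σ).obj S''₀))) :
    IrreducibleSpace ((baseChangeHom σ).obj S''₀).left := by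
  haveI := hS₀sm
  haveI := het
  haveI := hconn
  set g : (baseChangeHom σ).obj S''₀ ⟶ (baseChangeHom σ).obj S₀ := (baseChangeHom σ).map g₀
    with hg
  have hS'' : IsQuasiProjectiveOver ((baseChangeHom σ).obj S''₀) := hS''₀.baseChangeHom σ
  haveI : LocallyOfFiniteType ((baseChangeHom σ).obj S''₀).hom := hS''.locallyOfFiniteType
  haveI : AlgebraicGeometry.Smooth ((baseChangeHom σ).obj S₀).hom := by
    change AlgebraicGeometry.Smooth (pullback.snd S₀.hom _)
    infer_instance
  haveI : Etale g.left := by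
    letI := σ.toAlgebra
    exact MorphismProperty.IsStableUnderBaseChange.of_isPullback
      (Motives.isPullback_baseChange_map_left ℂ g₀).flip ‹Etale g₀.left›
  haveI : AlgebraicGeometry.Smooth ((baseChangeHom σ).obj S''₀).hom := by
    rw [← Over.w g]
    infer_instance
  exact irreducibleSpace_left_of_connectedSpace_complexPoints

/-- **The compactification input `hComp` with EGA II and Hironaka discharged**: as
`exists_smoothProjective_baseChangeHom_compactification_familyPullback`
(`HodgeGenericQbarDescentCompactification.lean`), but the quasi-projectivity of
`𝒳₀ ×_{S₀} S''₀` comes from `isQuasiProjectiveOver_familyPullback_of_isSeparated` (`S₀` is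
quasi-projective, hence separated over `ℚ̄`) and the smooth projective compactification over `ℚ̄`
from `exists_isSmoothProjective_isOpenImmersion` (Hironaka 1964, PROVED); the irreducibility of
`S'' = S''₀ ⊗_σ ℂ` is taken as a hypothesis (the shape of the input `hComp` of
`voisin2007_algebraic_of_finite_monodromyOrbit_of_qbar_of_classical_inputs`; from the connectedness
of `S''(ℂ)` it is `irreducibleSpace_baseChangeHom_obj_left_of_connectedSpace_complexPoints`). The
remaining steps (smoothness by descent from `ℂ`, irreducibility of `𝒳₀ ×_{S₀} S''₀`) are those of
the cited theorem. [cite: Voisin2007HodgeLoci, §3, proof of Prop. 1.7 ("a smooth projective compactification, defined over ℚ̄")]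
[cite: Hironaka1964, Main Theorem I] [cite: Hartshorne1977, II Cor. 4.6 and Ex. 4.9] -/
theorem exists_smoothProjective_baseChangeHom_compactification_familyPullback_of_isQuasiProjectiveOver
    (σ : AlgebraicClosure ℚ →+* ℂ) ⦃𝒳₀ S₀ S''₀ : SchemeOver (AlgebraicClosure ℚ)⦄
    (f₀ : 𝒳₀ ⟶ S₀) (g₀ : S''₀ ⟶ S₀) (n : ℕ) (h𝒳₀ : IsQuasiProjectiveOver 𝒳₀)
    (hS₀ : IsQuasiProjectiveOver S₀) (hS''₀ : IsQuasiProjectiveOver S''₀)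
    (hS₀sm : AlgebraicGeometry.Smooth S₀.hom) (het : Etale g₀.left)
    (hirr' : IrreducibleSpace ((baseChangeHom σ).obj S''₀).left)
    (hf : IsSmoothProjectiveFamily ((baseChangeHom σ).map f₀) n) :
    ∃ (m : ℕ) (Xbar₀ : SchemeOver (AlgebraicClosure ℚ))
      (i : familyPullback ((baseChangeHom σ).map f₀) ((baseChangeHom σ).map g₀) ⟶
        (baseChangeHom σ).obj Xbar₀),
      IsSmoothProjective m Xbar₀ ∧ IsOpenImmersion i.left := by
  haveI := het
  haveI := hS₀sm
  haveI := hirr'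
  set X₀ : SchemeOver (AlgebraicClosure ℚ) := familyPullback f₀ g₀ with hX₀
  -- (1) `X₀ = 𝒳₀ ×_{S₀} S''₀` is quasi-projective: a closed subscheme of `𝒳₀ ×_{ℚ̄} S''₀`
  haveI : IsSeparated S₀.hom := isSeparated_hom_of_isQuasiProjectiveOver hS₀
  have hX₀qp : IsQuasiProjectiveOver X₀ :=
    isQuasiProjectiveOver_familyPullback_of_isSeparated f₀ g₀ h𝒳₀ hS''₀
  -- (2) `X₀ → Spec ℚ̄` is smooth
  haveI : AlgebraicGeometry.Smooth ((baseChangeHom σ).map f₀).left := hf.smooth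
  haveI : AlgebraicGeometry.Smooth f₀.left := smooth_of_smooth_baseChangeHom_map_left σ f₀
  haveI : AlgebraicGeometry.Smooth 𝒳₀.hom := by
    rw [← Over.w f₀]
    infer_instance
  haveI : AlgebraicGeometry.Smooth X₀.hom := by
    change AlgebraicGeometry.Smooth (pullback.fst f₀.left g₀.left ≫ 𝒳₀.hom)
    infer_instance
  -- (3) `X₀` is irreducible (`X₀ ⊗_σ ℂ ≅ 𝒳 ×_S S''` is: smooth projective family over the
  -- irreducible `S'' = S''₀ ⊗_σ ℂ`)
  set g : (baseChangeHom σ).obj S''₀ ⟶ (baseChangeHom σ).obj S₀ := (baseChangeHom σ).map g₀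
    with hg
  have hS'' : IsQuasiProjectiveOver ((baseChangeHom σ).obj S''₀) := hS''₀.baseChangeHom σ
  haveI : LocallyOfFiniteType ((baseChangeHom σ).obj S''₀).hom := hS''.locallyOfFiniteType
  haveI : IrreducibleSpace (familyPullback ((baseChangeHom σ).map f₀) g).left :=
    irreducibleSpace_of_isSmoothProjectiveFamily _ (hf.familyPullback_snd g)
  obtain ⟨e, -, -⟩ := exists_familyPullback_iso_baseChangeHom_obj σ f₀ g₀
  set e' : (familyPullback ((baseChangeHom σ).map f₀) g).left ≅ ((baseChangeHom σ).obj X₀).left :=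
    (Over.forget _).mapIso e with he'
  haveI : IrreducibleSpace ((baseChangeHom σ).obj X₀).left :=
    (Scheme.homeoOfIso e').surjective.irreducibleSpace (Scheme.homeoOfIso e').continuous
  haveI : IrreducibleSpace X₀.left := irreducibleSpace_of_irreducibleSpace_baseChangeHom_obj σ X₀
  -- (4) pure dimension and Hironaka over `ℚ̄` (PROVED: `exists_isSmoothProjective_isOpenImmersion`)
  obtain ⟨m, hm⟩ := exists_smoothOfRelativeDimension_of_smooth X₀.hom
  obtain ⟨Xbar₀, i₀, hXbar₀, hi₀⟩ := exists_isSmoothProjective_isOpenImmersion m X₀ hm hX₀qp inferInstance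
  haveI := hi₀
  refine ⟨m, Xbar₀, e.hom ≫ (baseChangeHom σ).map i₀, hXbar₀, ?_⟩
  haveI := isOpenImmersion_baseChangeHom_map_left σ i₀
  haveI : IsOpenImmersion e.hom.left :=
    (inferInstance : IsOpenImmersion ((Over.forget _).mapIso e).hom)
  rw [Over.comp_left]
  infer_instance

/-- **Voisin 2007, Prop. 0.7 (= arXiv Prop. 1.7) from three named facts and the two theorems of
SGA1** — the assembled proof `voisin2007_algebraic_of_finite_monodromyOrbit_of_qbar_of_inputs`
(`HodgeGenericQbarDescentFiniteMonodromyProofs.lean`) with its covering input supplied by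
`finiteCovering_descends_to_qbar_of_riemannExistence_of_smooth`, its compactification input by
`exists_smoothProjective_baseChangeHom_compactification_familyPullback_of_isQuasiProjectiveOver`
(Hironaka PROVED, EGA II not needed), and its pull-back input by the named fact
`fulton1998_map_mem_algebraicClasses`. Remaining inputs:

* `hRiemann` — Riemann existence theorem [SGA1, Exp. XII Thm. 5.1];
* `hDescent` — finite étale covers of `S₀ ⊗_{ℚ̄} ℂ` descend to `ℚ̄` [SGA1, Exp. XIII Prop. 4.6];
* `hGICT` — the named fact `deligne_globalInvariantCycles` [Deligne, Hodge II, Thm. 4.1.1];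
* `hpol` — the named fact `smoothProjective_hodgeStructure_isPolarizable` [Voisin I, Thm. 6.32];
* `hPull` — the named fact `fulton1998_map_mem_algebraicClasses` [Fulton 1998, Cor. 19.2 (b)].
[cite: Voisin2007HodgeLoci, §3, proof of Prop. 1.7 (arXiv math/0605766 p. 7; Compositio Prop. 0.7)]
[cite: SGA1, Exp. XII Thm. 5.1 and Exp. XIII Prop. 4.6] [cite: Hironaka1964, Main Theorem I]
[cite: DeligneHodgeII1971, Théorème 4.1.1] [cite: Fulton1998, Cor. 19.2 (b)] -/
theorem voisin2007_algebraic_of_finite_monodromyOrbit_of_qbar_of_riemannExistence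
    (hRiemann : ∀ (S : SchemeOver ℂ), IsQuasiProjectiveOver S →
      ∀ (T : Type) [TopologicalSpace T] (q : T → ComplexPoints S),
        IsCoveringMap q → (∀ t, (q ⁻¹' {t}).Finite) →
        ∃ (S' : SchemeOver ℂ) (g : S' ⟶ S) (Φ : ComplexPoints S' ≃ₜ T),
          IsFinite g.left ∧ Etale g.left ∧ ∀ z, q (Φ z) = AlgPoints.map g z)
    (hDescent : ∀ (σ : AlgebraicClosure ℚ →+* ℂ) (S₀ : SchemeOver (AlgebraicClosure ℚ)),
      IsQuasiProjectiveOver S₀ → IrreducibleSpace S₀.left →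
      ∀ ⦃S' : SchemeOver ℂ⦄ (g : S' ⟶ (baseChangeHom σ).obj S₀),
        IsFinite g.left → Etale g.left → ConnectedSpace S'.left →
        ∃ (S''₀ : SchemeOver (AlgebraicClosure ℚ)) (g₀ : S''₀ ⟶ S₀)
          (e : (baseChangeHom σ).obj S''₀ ≅ S'),
          IsFinite g₀.left ∧ Etale g₀.left ∧ e.hom ≫ g = (baseChangeHom σ).map g₀)
    (hGICT : deligne_globalInvariantCycles) (hpol : smoothProjective_hodgeStructure_isPolarizable)
    (hPull : fulton1998_map_mem_algebraicClasses) :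
    voisin2007_algebraic_of_finite_monodromyOrbit_of_qbar :=
  voisin2007_algebraic_of_finite_monodromyOrbit_of_qbar_of_inputs
    (fun σ S₀ hS₀ hS₀sm hS₀irr T _ _ q hq hqfin ↦
      finiteCovering_descends_to_qbar_of_riemannExistence_of_smooth hRiemann hDescent σ S₀ hS₀ hS₀sm
        hS₀irr T q hq hqfin)
    (fun σ _ _ _ f₀ g₀ n h𝒳₀ hS₀ hS''₀ hS₀sm _ het hconn hf ↦
      exists_smoothProjective_baseChangeHom_compactification_familyPullback_of_isQuasiProjectiveOver
        σ f₀ g₀ n h𝒳₀ hS₀ hS''₀ hS₀sm het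
        (irreducibleSpace_baseChangeHom_obj_left_of_connectedSpace_complexPoints σ g₀ hS''₀ hS₀sm het
          hconn) hf)
    hGICT hpol (fun _ _ _ _ hX hY g p _ ha ↦ hPull g hY hX p _ ha)

/-- **Voisin 2007, Prop. 0.7 (= arXiv Prop. 1.7) from FOUR NAMED FACTS of the tree** — the
assembled proof `voisin2007_algebraic_of_finite_monodromyOrbit_of_qbar_of_classical_inputs`
(`HodgeGenericQbarDescentProofs.lean`: finite orbit ⟹ finite-index stabiliser; the étale cover;
invariance on the cover; global invariant cycles; Hodge classes of the compactification; the Hodge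
conjecture applied there; restriction back) with

* `hRE` := the named fact `FundamentalGroup.riemannExistence_qbarDescent_of_finiteIndex`
  (Riemann existence with descent to `ℚ̄`, SGA1 XII Thm. 5.1 and XIII Prop. 4.6, in the
  `π₁`/finite-index shape; its proved projection `.hRE`);
* `hComp` := PROVED here
  (`exists_smoothProjective_baseChangeHom_compactification_familyPullback_of_isQuasiProjectiveOver`:
  Hironaka's smooth projective compactification over `ℚ̄` from the strong projective resolution
  `Resolution/ProjectiveStrongResolution.lean`, quasi-projectivity of the fibre product by Segre and
  the diagonal; the conclusion is transported to `ℂ` by `IsSmoothProjective.baseChangeHom_holds`);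
* `hD` := the named fact `deligne_globalInvariantCycles` (Deligne, Hodge II, Thm. 4.1.1);
* `hpol` := the named fact `smoothProjective_hodgeStructure_isPolarizable` (Voisin I, Thm. 6.32);
* `hPull` := the named fact `fulton1998_map_mem_algebraicClasses` (Fulton 1998, Cor. 19.2 (b)),
  whose statement is verbatim the hypothesis.

Hence the named fact `voisin2007_algebraic_of_finite_monodromyOrbit_of_qbar` is reduced, inside the
tree and with no anonymous hypothesis left, to these four vendored classical theorems.
[cite: Voisin2007HodgeLoci, §3, proof of Prop. 1.7 (arXiv math/0605766 p. 7; Compositio 143 (2007) Prop. 0.7)]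
[cite: SGA1, Exp. XII Thm. 5.1 and Exp. XIII Prop. 4.6] [cite: Hironaka1964, Main Theorem I]
[cite: DeligneHodgeII1971, Théorème 4.1.1] [cite: Fulton1998, Cor. 19.2 (b)] -/
theorem voisin2007_algebraic_of_finite_monodromyOrbit_of_qbar_of_namedFacts
    (hRE : FundamentalGroup.riemannExistence_qbarDescent_of_finiteIndex)
    (hGICT : deligne_globalInvariantCycles) (hpol : smoothProjective_hodgeStructure_isPolarizable)
    (hPull : fulton1998_map_mem_algebraicClasses) :
    voisin2007_algebraic_of_finite_monodromyOrbit_of_qbar :=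
  voisin2007_algebraic_of_finite_monodromyOrbit_of_qbar_of_classical_inputs hRE.hRE
    (fun σ _ _ _ f₀ g₀ n h𝒳₀ hS₀ hS₀' _ hS₀sm het hirr' hf ↦ by
      obtain ⟨m, Xbar₀, i, hXbar₀, hi⟩ :=
        exists_smoothProjective_baseChangeHom_compactification_familyPullback_of_isQuasiProjectiveOver
          σ f₀ g₀ n h𝒳₀ hS₀ hS₀' hS₀sm het hirr' hf
      exact ⟨m, Xbar₀, i, IsSmoothProjective.baseChangeHom_holds σ hXbar₀, hi⟩)
    hGICT hpol (fun _ _ _ _ g hY hX p _ ha ↦ hPull g hY hX p _ ha)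

/-- **Voisin 2007, Prop. 0.7 (= arXiv Prop. 1.7) from THREE unproved named facts** —
`voisin2007_algebraic_of_finite_monodromyOrbit_of_qbar_of_namedFacts` with the polarisability of
the Hodge structure of a smooth projective variety supplied by the tree's theorem
`smoothProjective_hodgeStructure_isPolarizable_holds` (Voisin I §7.1.2, PROVED in
`HodgeRiemannPolarizabilityProofs.lean`). What remains: Riemann existence with descent to `ℚ̄`
(`FundamentalGroup.riemannExistence_qbarDescent_of_finiteIndex`), Deligne's global invariant
cycles theorem (`deligne_globalInvariantCycles`) and Fulton's pull-back of algebraic classes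
(`fulton1998_map_mem_algebraicClasses`); `…_holds` is this theorem applied to their discharges.
[cite: Voisin2007HodgeLoci, §3, proof of Prop. 1.7 (arXiv math/0605766 p. 7; Compositio 143 (2007) Prop. 0.7)]
[cite: SGA1, Exp. XII Thm. 5.1 and Exp. XIII Prop. 4.6] [cite: DeligneHodgeII1971, Théorème 4.1.1]
[cite: Fulton1998, Cor. 19.2 (b)] [cite: VoisinHodgeI2002, Thm. 6.32 and §7.1.2] -/
theorem voisin2007_algebraic_of_finite_monodromyOrbit_of_qbar_of_threeNamedFacts
    (hRE : FundamentalGroup.riemannExistence_qbarDescent_of_finiteIndex)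
    (hGICT : deligne_globalInvariantCycles) (hPull : fulton1998_map_mem_algebraicClasses) :
    voisin2007_algebraic_of_finite_monodromyOrbit_of_qbar :=
  voisin2007_algebraic_of_finite_monodromyOrbit_of_qbar_of_namedFacts hRE hGICT
    smoothProjective_hodgeStructure_isPolarizable_holds hPull

end WithoutEGAII


end Literature.AlgebraicGeometry.HodgeTheory

end
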